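/-
Copyright: statement-level skeleton of a published paper (lit-balaban cell, Phase-2 proof seat p39 gen 9). No proof claims
beyond what the kernel checks below.
-/
import Literature.MathematicalPhysics.QuantumFieldTheory.Balaban1983to89.B3ZdLatticeProfileSums

/-!
# B3 — T. Bałaban, *(Higgs)₂,₃ quantum fields in a finite volume. III. Renormalization*, CMP **88** (1983) 411–445
[Balaban1983Higgs3], p. 437 / p. 441: MODEL-FREE KERNEL CALCULUS ON ξℤ³ — the composition of two once-differentiated propagator
profiles `(ξ·max(1,|u|_∞))^{−2}e^{−δξ|u|_∞}` is a propagator profile `(ξ·max(1,|u|_∞))^{−1}e^{−(δ/2)ξ|u|_∞}` (the lattice Riesz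
composition `|u|^{−2} ⋆ |u|^{−2} ≲ |u|^{−1}` in three dimensions, UNIFORMLY in the spacing `0 < ξ ≤ 1`), block averaging preserves the
profiles, and the small profile algebra used with them

statement-level skeleton of published theorems with citation tags; proofs where landed; nothing here is a claim about
the Yang–Mills mass gap

PDF held: `paper:balaban1983-higgs-2-3-quantum-fields-finite-volume` (journal page = PDF page + 410); p. 437 [PDF 27] and p. 441
[PDF 31] read on the ×2 renders `run/shared/lean/pub/pub-balaban/b2b-balaban-ref1/pages/1983-cmp88-higgs23-III/
1983-cmp88-higgs23-III-p027-x2.png`, `…-p031-x2.png`.  Rows **B3.Eq3.11-3.17** (p. 437: *"Using the inequalities |C^ξ(y − y′)| ≦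
O(1)e^{−½|y−y′|}/|y − y′|, |G^ξ_{j″}(0; y, y′)| ≦ O(1)e^{−δ₀|y−y′|}/|y − y′|, and the corresponding inequalities for derivatives, we
can estimate (3.16) by a constant"*) and **B3.Eq3.25-3.32** (p. 441: *"If at least one propagator G_{j₀}(0) is replaced by
G_{j₀}(0)(1 − m²_{j₀} − a_{j₀}P_{j₀})C^ξ, then we get a convergent expression"*) of `HOME/lit-balaban-r15/ROWS-B3.md` (fold owner
r15): file 2 of the p39 gen-9 programme «the §3 sentences on the PRINTED infinite lattice ξℤ³» — the torus versions of these
lemmas are this seat's gen-6/7 `B3KernelConvolutionTorus(Sharp)`/`B3KernelBlockSmearing`; here the sums run over ℤ³ (`tsum`s,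
bounded through their finite partial sums and gen-8's shell counting `B3ZdLatticeProfileSums.sum_radial_le`).
WHAT IS PROVED (sites `ZSite 3 = Fin 3 → ℤ`, `|·| = B3CxiUniformBound.supNorm`, profiles
`P_q^δ(u) = (ξ·max(1,|u|))^{−q}e^{−δξ|u|}`, `0 < ξ ≤ 1`, `0 < δ ≤ 1`):
* §1 profile algebra: `P_q ≤ ξ^{−1}P_{q−1}` (`profile_succ_le_inv_mul`), `P₁^δ ≤ (1 + 2/δ)·P₂^{δ/2}` (`profile_one_le_two_half`),
  evenness `P(−u) = P(u)`.
* §2 one-dimensional sums: `Σ_{m ≤ n < b} n^{−2} ≤ 1/(m−1)` (`m ≥ 2`), `Σ_{1 ≤ n < b} n^{−2} ≤ 2`.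
* §3 **`conv22_le`** — THE SHARP COMPOSITION: for every `v ∈ ℤ³`, `w ↦ ξ³P₂^δ(w)P₂^δ(v − w)` is summable and
  `Σ'_w ξ³P₂^δ(w)P₂^δ(v−w) ≤ 1400·P₁^{δ/2}(v)` (`0 < ξ`, `0 < δ`); two-point form `conv22_le₂`: `Σ'_z ξ³P₂(x−z)P₂(z−y) ≤
  1400·P₁^{δ/2}(x−y)`; finite partial sums `conv22_sum_le`.  Route: a pointwise four-region majorant (`2|w| < |v|`: the second
  factor is far; `2|v−w| < |v|`: the first is; the annulus `|w| < 2|v|`: both are, and there are `≤ 64|v|³` sites;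
  `|w| ≥ 2|v|`: `|v − w| ≥ |w|/2`, a tail `Σ_{n ≥ 2|v|} n^{−2} ≤ 1/|v|`), each region summed radially (`sum_ball_profile_two_le`,
  `sum_tail_profile_le`, `card_filter_supNorm_lt_le`); at `v = 0` directly `Σ_n n^{−2} ≤ 2`.
* §4 **`blockSum_profile_le`** — BLOCK AVERAGING PRESERVES PROFILES: for a finite `S ⊂ ℤ³` all of whose sites are within sup
  distance `< n = ξ^{−1}` of `z`, with `#S ≤ n³`, and `q ≤ 2`: `Σ_{z′∈S} ξ³P_q^δ(z′ − y) ≤ 2812e²·P_q^δ(z − y)` — the averaging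
  operator `P_k = Q_k^*Q_k` of (3.16) (unit blocks of `n³` fine sites) maps a profile-bounded kernel to a profile-bounded kernel.
* §5 `tsum_profile_shift_le` (the `L¹` bounds `≤ 833/δ³` after the translations `z ↦ x − z`, `z ↦ z − y`), `profile_le_inv_pow`
  (`P_q ≤ ξ^{−q}`) and **`tsum_profile_one_mul_le`**: `Σ'_z ξ³P₁^δ(x−z)P₁^δ(z−y) ≤ 833/δ³` for all `x, y` (AM–GM and `P₁² ≤ P₂`) —
  the undifferentiated propagator pairs of (3.16)/(3.26) are summable uniformly in the spacing and the positions.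
Mathlib + the cited tree file only; theorems only, no definitions, no named facts; standard axioms.  Unit `lit-balaban-p39-g9`
(Phase-2 proof seat p39, gen 9), HOME `run/shared/lean/pub/lit-balaban/`, 2026-08-22.
-/

open scoped BigOperators
open Finset

namespace Literature.MathematicalPhysics.QuantumFieldTheory.Balaban1983to89.B3ZdKernelConvolutions

open B3Sect3VectorSelfEnergy B3CxiUniformBound B3ZdLatticeProfileSums

noncomputable section

/-! ## §1 Profile algebra -/

section Algebra

variable {d : ℕ} {ξ δ : ℝ}

/-- kernel: one inverse power of the regularised distance costs at most `ξ^{−1}`: `P_{q+1}(u) ≤ ξ^{−1}·P_q(u)` (`0 < ξ`).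
[cite: Balaban1983Higgs3, (3.16) p.437] -/
theorem profile_succ_le_inv_mul (hξ : 0 < ξ) (q : ℕ) (δ : ℝ) (u : ZSite d) :
    ((ξ * max 1 (supNorm u : ℝ)) ^ (q + 1))⁻¹ * Real.exp (-(δ * (ξ * (supNorm u : ℝ)))) ≤
      ξ⁻¹ * (((ξ * max 1 (supNorm u : ℝ)) ^ q)⁻¹ * Real.exp (-(δ * (ξ * (supNorm u : ℝ))))) := by
  have hm : (1 : ℝ) ≤ max 1 (supNorm u : ℝ) := le_max_left _ _
  have hx : 0 < ξ * max 1 (supNorm u : ℝ) := by positivity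
  have hA : ((ξ * max 1 (supNorm u : ℝ)) ^ (q + 1))⁻¹ ≤ ξ⁻¹ * ((ξ * max 1 (supNorm u : ℝ)) ^ q)⁻¹ := by
    rw [pow_succ, mul_inv, mul_comm]
    refine mul_le_mul_of_nonneg_right ?_ (by positivity)
    exact inv_anti₀ hξ (le_mul_of_one_le_right hξ.le hm)
  calc ((ξ * max 1 (supNorm u : ℝ)) ^ (q + 1))⁻¹ * Real.exp (-(δ * (ξ * (supNorm u : ℝ))))
      ≤ (ξ⁻¹ * ((ξ * max 1 (supNorm u : ℝ)) ^ q)⁻¹) * Real.exp (-(δ * (ξ * (supNorm u : ℝ)))) :=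
        mul_le_mul_of_nonneg_right hA (Real.exp_pos _).le
    _ = _ := mul_assoc _ _ _

/-- kernel: `x·e^{−cx} ≤ 1/c` for `x ≥ 0`, `c > 0` (from `1 + cx ≤ e^{cx}`). [folklore] -/
private theorem mul_exp_neg_le {c : ℝ} (hc : 0 < c) (x : ℝ) : x * Real.exp (-(c * x)) ≤ 1 / c := by
  have h : c * x ≤ Real.exp (c * x) := by linarith [Real.add_one_le_exp (c * x)]
  have hE : 0 ≤ Real.exp (-(c * x)) := (Real.exp_pos _).le
  calc x * Real.exp (-(c * x)) = c * x * Real.exp (-(c * x)) / c := by field_simp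
    _ ≤ Real.exp (c * x) * Real.exp (-(c * x)) / c := by gcongr
    _ = 1 / c := by rw [← Real.exp_add, add_neg_cancel, Real.exp_zero]

/-- kernel: a propagator profile is a once-differentiated profile at half the decay rate, `P₁^δ(u) ≤ (1 + 2/δ)·P₂^{δ/2}(u)`
(`0 < ξ ≤ 1`, `0 < δ`): the displacement-weighted or undifferentiated factors of (3.26)/(3.27) fit the `P₂` slot of the
composition lemma. [cite: Balaban1983Higgs3, (3.26) p.441] -/
theorem profile_one_le_two_half (hξ : 0 < ξ) (hξ1 : ξ ≤ 1) (hδ : 0 < δ) (u : ZSite d) :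
    ((ξ * max 1 (supNorm u : ℝ)) ^ 1)⁻¹ * Real.exp (-(δ * (ξ * (supNorm u : ℝ)))) ≤
      (1 + 2 / δ) * (((ξ * max 1 (supNorm u : ℝ)) ^ 2)⁻¹ * Real.exp (-(δ / 2 * (ξ * (supNorm u : ℝ))))) := by
  set n : ℝ := (supNorm u : ℝ) with hn
  have hn0 : 0 ≤ n := by rw [hn]; exact_mod_cast Nat.zero_le _
  set m : ℝ := max 1 n with hm
  have hm1 : 1 ≤ m := le_max_left _ _
  have hx : 0 < ξ * m := by positivity
  -- the key factor `ξ·m·e^{−(δ/2)ξn} ≤ 1 + 2/δ`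
  have hkey : ξ * m * Real.exp (-(δ / 2 * (ξ * n))) ≤ 1 + 2 / δ := by
    rcases le_or_gt 1 n with h1 | h1
    · have hmn : m = n := max_eq_right h1
      rw [hmn]
      have := mul_exp_neg_le (half_pos hδ) (ξ * n)
      rw [show 1 / (δ / 2) = 2 / δ by field_simp] at this
      linarith
    · have hn0' : n = 0 := by
        have : supNorm u < 1 := by exact_mod_cast (show (supNorm u : ℝ) < 1 from h1)
        rw [hn]; exact_mod_cast (show supNorm u = 0 by omega)
      have hm0 : m = 1 := by rw [hm, hn0']; exact max_eq_left zero_le_one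
      rw [hm0, hn0', mul_zero, mul_zero, neg_zero, Real.exp_zero, mul_one, mul_one]
      have : 0 < 2 / δ := by positivity
      linarith
  have hsplit : Real.exp (-(δ * (ξ * n))) = Real.exp (-(δ / 2 * (ξ * n))) * Real.exp (-(δ / 2 * (ξ * n))) := by
    rw [← Real.exp_add]; ring_nf
  rw [pow_one, hsplit]
  calc (ξ * m)⁻¹ * (Real.exp (-(δ / 2 * (ξ * n))) * Real.exp (-(δ / 2 * (ξ * n))))
      = ((ξ * m) ^ 2)⁻¹ * (ξ * m * Real.exp (-(δ / 2 * (ξ * n)))) * Real.exp (-(δ / 2 * (ξ * n))) := by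
        field_simp
    _ ≤ ((ξ * m) ^ 2)⁻¹ * (1 + 2 / δ) * Real.exp (-(δ / 2 * (ξ * n))) := by gcongr
    _ = (1 + 2 / δ) * (((ξ * m) ^ 2)⁻¹ * Real.exp (-(δ / 2 * (ξ * n)))) := by ring

/-- kernel: the profiles are even, `P(−u) = P(u)`. [cite: Balaban1983Higgs3, (3.27) p.441] -/
theorem profile_neg (ξ δ : ℝ) (q : ℕ) (u : ZSite d) :
    ((ξ * max 1 (supNorm (-u) : ℝ)) ^ q)⁻¹ * Real.exp (-(δ * (ξ * (supNorm (-u) : ℝ)))) =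
      ((ξ * max 1 (supNorm u : ℝ)) ^ q)⁻¹ * Real.exp (-(δ * (ξ * (supNorm u : ℝ)))) := by
  rw [supNorm_neg]

/-- kernel: `|v − w| = |w − v|` inside a profile. [cite: Balaban1983Higgs3, (3.27) p.441] -/
theorem profile_sub_comm (ξ δ : ℝ) (q : ℕ) (v w : ZSite d) :
    ((ξ * max 1 (supNorm (v - w) : ℝ)) ^ q)⁻¹ * Real.exp (-(δ * (ξ * (supNorm (v - w) : ℝ)))) =
      ((ξ * max 1 (supNorm (w - v) : ℝ)) ^ q)⁻¹ * Real.exp (-(δ * (ξ * (supNorm (w - v) : ℝ)))) := by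
  rw [← neg_sub w v, supNorm_neg]

/-- kernel: a profile with a smaller decay rate dominates, `P_q^δ ≤ P_q^{δ′}` for `δ′ ≤ δ` (`0 ≤ ξ`). [cite: Balaban1983Higgs3, (3.16) p.437] -/
theorem profile_mono_rate {δ' : ℝ} (hξ : 0 ≤ ξ) (h : δ' ≤ δ) (q : ℕ) (u : ZSite d) :
    ((ξ * max 1 (supNorm u : ℝ)) ^ q)⁻¹ * Real.exp (-(δ * (ξ * (supNorm u : ℝ)))) ≤
      ((ξ * max 1 (supNorm u : ℝ)) ^ q)⁻¹ * Real.exp (-(δ' * (ξ * (supNorm u : ℝ)))) := by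
  refine mul_le_mul_of_nonneg_left (Real.exp_le_exp.2 ?_) (by positivity)
  have : 0 ≤ ξ * (supNorm u : ℝ) := by positivity
  nlinarith

end Algebra

/-! ## §2 One-dimensional sums -/

/-- kernel: `Σ_{m ≤ n < b} n^{−2} ≤ 1/(m−1)` for `m ≥ 2` (telescoping `n^{−2} ≤ (n−1)^{−1} − n^{−1}`). [folklore] -/
private theorem sum_Ico_inv_sq_le {m : ℕ} (hm : 2 ≤ m) (b : ℕ) :
    ∑ n ∈ Finset.Ico m b, ((n : ℝ) ^ 2)⁻¹ ≤ 1 / ((m : ℝ) - 1) := by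
  have hstep : ∀ n : ℕ, 2 ≤ n → ((n : ℝ) ^ 2)⁻¹ ≤ 1 / ((n : ℝ) - 1) - 1 / (n : ℝ) := by
    intro n hn
    have hn2 : (2 : ℝ) ≤ n := by exact_mod_cast hn
    have h1 : 0 < (n : ℝ) - 1 := by linarith
    have h2 : 0 < (n : ℝ) := by linarith
    rw [div_sub_div _ _ h1.ne' h2.ne', inv_eq_one_div, div_le_div_iff₀ (by positivity) (by positivity)]
    nlinarith
  -- telescoping by induction on `b`
  suffices h : ∀ b, m ≤ b → ∑ n ∈ Finset.Ico m b, ((n : ℝ) ^ 2)⁻¹ ≤ 1 / ((m : ℝ) - 1) - 1 / ((b : ℝ) - 1) by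
    rcases le_or_gt m b with hb | hb
    · have hb1 : 0 ≤ 1 / ((b : ℝ) - 1) := by
        have : (2 : ℝ) ≤ b := by exact_mod_cast hm.trans hb
        have : 0 < (b : ℝ) - 1 := by linarith
        positivity
      linarith [h b hb]
    · rw [Finset.Ico_eq_empty (by omega), Finset.sum_empty]
      have : (2 : ℝ) ≤ m := by exact_mod_cast hm
      have : 0 < (m : ℝ) - 1 := by linarith
      positivity
  intro b hb
  induction b, hb using Nat.le_induction with
  | base => simp
  | succ b hb ih =>
      rw [Finset.sum_Ico_succ_top hb]
      have hs := hstep b (hm.trans hb)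
      have : 1 / ((b : ℝ) - 1) - 1 / (b : ℝ) + (1 / ((m : ℝ) - 1) - 1 / ((b : ℝ) - 1))
          = 1 / ((m : ℝ) - 1) - 1 / (((b + 1 : ℕ) : ℝ) - 1) := by
        push_cast; ring
      linarith

/-- kernel: `Σ_{1 ≤ n < b} n^{−2} ≤ 2`. [folklore] -/
private theorem sum_Ico_one_inv_sq_le (b : ℕ) : ∑ n ∈ Finset.Ico 1 b, ((n : ℝ) ^ 2)⁻¹ ≤ 2 := by
  rcases le_or_gt b 1 with hb | hb
  · rw [Finset.Ico_eq_empty (by omega), Finset.sum_empty]; norm_num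
  · rw [← Finset.sum_Ico_consecutive _ (by norm_num : 1 ≤ 2) (by omega : 2 ≤ b), Finset.sum_Ico_succ_top (by norm_num),
      Finset.Ico_self, Finset.sum_empty]
    have h := sum_Ico_inv_sq_le (le_refl 2) b
    norm_num at h ⊢
    linarith


/-! ## §3 The sharp composition `P₂ ⋆ P₂ ≲ P₁` on ξℤ³ -/

section Conv

variable {ξ δ : ℝ}

/-- kernel: the LOCAL MASS of the once-differentiated profile — inside the ball `2|w| < R` the sum `Σ ξ³P₂^δ(w)` is at most
`27·ξ·R` (`0 < ξ ≤ 1`, `0 ≤ δ`, `R ≥ 1`; any finite set of sites). [cite: Balaban1983Higgs3, (3.16) p.437] -/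
theorem sum_ball_profile_two_le (hξ : 0 < ξ) (hδ : 0 ≤ δ) {R : ℕ} (hR : 1 ≤ R) (F : Finset (ZSite 3)) :
    ∑ w ∈ F, (if 2 * supNorm w < R then
        ξ ^ 3 * (((ξ * max 1 (supNorm w : ℝ)) ^ 2)⁻¹ * Real.exp (-(δ * (ξ * (supNorm w : ℝ))))) else 0)
      ≤ 27 * ξ * R := by
  set h : ℕ → ℝ := fun n => if 2 * n < R then
      ξ ^ 3 * (((ξ * max 1 (n : ℝ)) ^ 2)⁻¹ * Real.exp (-(δ * (ξ * (n : ℝ))))) else 0 with hh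
  have hh0 : ∀ n, 0 ≤ h n := fun n => by simp only [hh]; split_ifs <;> positivity
  have hR1 : (1 : ℝ) ≤ R := by exact_mod_cast hR
  have hterm : ∀ n : ℕ, 1 ≤ n → 26 * (n : ℝ) ^ 2 * h n ≤ if n < R then 26 * ξ else 0 := by
    intro n hn
    have hn1 : (1 : ℝ) ≤ n := by exact_mod_cast hn
    simp only [hh]
    by_cases h2 : 2 * n < R
    · rw [if_pos h2, if_pos (by omega), max_eq_right hn1]
      have hE : Real.exp (-(δ * (ξ * (n : ℝ)))) ≤ 1 := Real.exp_le_one_iff.2 (by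
        have : 0 ≤ δ * (ξ * (n : ℝ)) := by positivity
        linarith)
      have hn0 : (n : ℝ) ≠ 0 := by linarith
      calc 26 * (n : ℝ) ^ 2 * (ξ ^ 3 * (((ξ * n) ^ 2)⁻¹ * Real.exp (-(δ * (ξ * (n : ℝ))))))
          ≤ 26 * (n : ℝ) ^ 2 * (ξ ^ 3 * (((ξ * n) ^ 2)⁻¹ * 1)) := by gcongr
        _ = 26 * ξ := by field_simp
    · rw [if_neg h2]
      split_ifs
      · simp only [mul_zero]; positivity
      · simp
  calc ∑ w ∈ F, (if 2 * supNorm w < R then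
          ξ ^ 3 * (((ξ * max 1 (supNorm w : ℝ)) ^ 2)⁻¹ * Real.exp (-(δ * (ξ * (supNorm w : ℝ))))) else 0)
      = ∑ w ∈ F, h (supNorm w) := by simp only [hh]
    _ ≤ h 0 + ∑ n ∈ Finset.Ico 1 (F.sup supNorm + 1), 26 * (n : ℝ) ^ 2 * h n := sum_radial_le h hh0 F
    _ ≤ ξ + ∑ n ∈ Finset.Ico 1 (F.sup supNorm + 1), (if n < R then 26 * ξ else 0) := by
        gcongr with n hn
        · simp only [hh, Nat.cast_zero, mul_zero, max_eq_left (zero_le_one' ℝ), mul_one, neg_zero, Real.exp_zero]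
          split_ifs
          · calc ξ ^ 3 * (ξ ^ 2)⁻¹ = ξ := by field_simp
              _ ≤ ξ := le_rfl
          · exact hξ.le
        · exact hterm n (Finset.mem_Ico.1 hn).1
    _ ≤ ξ + 26 * ξ * R := by
        gcongr
        calc ∑ n ∈ Finset.Ico 1 (F.sup supNorm + 1), (if n < R then 26 * ξ else (0 : ℝ))
            = ∑ n ∈ (Finset.Ico 1 (F.sup supNorm + 1)).filter (fun n => n < R), 26 * ξ := by
              rw [Finset.sum_filter]
          _ = ((Finset.Ico 1 (F.sup supNorm + 1)).filter (fun n => n < R)).card * (26 * ξ) := by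
              rw [Finset.sum_const, nsmul_eq_mul]
          _ ≤ R * (26 * ξ) := by
              gcongr
              have hsub : (Finset.Ico 1 (F.sup supNorm + 1)).filter (fun n => n < R) ⊆ Finset.range R := by
                intro n hn
                rw [Finset.mem_filter] at hn
                exact Finset.mem_range.2 hn.2
              have := Finset.card_le_card hsub
              rw [Finset.card_range] at this
              exact_mod_cast this
          _ = 26 * ξ * R := by ring
    _ ≤ 27 * ξ * R := by nlinarith

/-- kernel: the TAIL of the composition — beyond `|w| ≥ 2R` the summands `ξ³P₂^δ(w)·4P₂^{δ/2}(w)` add up to at most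
`104·(ξR)^{−1}e^{−2δξR}` (`Σ_{n ≥ 2R} n^{−2} ≤ 1/R`). [cite: Balaban1983Higgs3, (3.16) p.437] -/
theorem sum_tail_profile_le (hξ : 0 < ξ) (hδ : 0 ≤ δ) {R : ℕ} (hR : 1 ≤ R) (F : Finset (ZSite 3)) :
    ∑ w ∈ F, (if 2 * R ≤ supNorm w then
        ξ ^ 3 * ((((ξ * max 1 (supNorm w : ℝ)) ^ 2)⁻¹ * Real.exp (-(δ * (ξ * (supNorm w : ℝ))))) *
          (4 * ((ξ * max 1 (supNorm w : ℝ)) ^ 2)⁻¹)) else 0)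
      ≤ 104 * ((ξ * R)⁻¹ * Real.exp (-(2 * δ * (ξ * R)))) := by
  set h : ℕ → ℝ := fun n => if 2 * R ≤ n then
      ξ ^ 3 * ((((ξ * max 1 (n : ℝ)) ^ 2)⁻¹ * Real.exp (-(δ * (ξ * (n : ℝ))))) * (4 * ((ξ * max 1 (n : ℝ)) ^ 2)⁻¹))
      else 0 with hh
  have hh0 : ∀ n, 0 ≤ h n := fun n => by simp only [hh]; split_ifs <;> positivity
  have hR1 : (1 : ℝ) ≤ R := by exact_mod_cast hR
  have hE0 : 0 < Real.exp (-(2 * δ * (ξ * R))) := Real.exp_pos _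
  -- the shell terms
  have hterm : ∀ n : ℕ, 1 ≤ n → 26 * (n : ℝ) ^ 2 * h n ≤
      if 2 * R ≤ n then 104 * ξ⁻¹ * Real.exp (-(2 * δ * (ξ * R))) * ((n : ℝ) ^ 2)⁻¹ else 0 := by
    intro n hn
    simp only [hh]
    by_cases h2 : 2 * R ≤ n
    · rw [if_pos h2, if_pos h2]
      have hn2 : (2 : ℝ) * R ≤ n := by exact_mod_cast h2
      have hn1 : (1 : ℝ) ≤ n := by linarith
      rw [max_eq_right hn1]
      have hE : Real.exp (-(δ * (ξ * (n : ℝ)))) ≤ Real.exp (-(2 * δ * (ξ * R))) :=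
        Real.exp_le_exp.2 (by nlinarith [mul_nonneg hδ hξ.le])
      have hn0 : (0 : ℝ) < n := by linarith
      calc 26 * (n : ℝ) ^ 2 * (ξ ^ 3 * ((((ξ * n) ^ 2)⁻¹ * Real.exp (-(δ * (ξ * (n : ℝ))))) * (4 * ((ξ * n) ^ 2)⁻¹)))
          ≤ 26 * (n : ℝ) ^ 2 * (ξ ^ 3 * ((((ξ * n) ^ 2)⁻¹ * Real.exp (-(2 * δ * (ξ * R)))) * (4 * ((ξ * n) ^ 2)⁻¹))) := by
            gcongr
        _ = 104 * ξ⁻¹ * Real.exp (-(2 * δ * (ξ * R))) * ((n : ℝ) ^ 2)⁻¹ := by field_simp; norm_num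
    · rw [if_neg h2, if_neg h2]; simp
  have hz : h 0 = 0 := by simp only [hh]; rw [if_neg (by omega)]
  calc ∑ w ∈ F, (if 2 * R ≤ supNorm w then
          ξ ^ 3 * ((((ξ * max 1 (supNorm w : ℝ)) ^ 2)⁻¹ * Real.exp (-(δ * (ξ * (supNorm w : ℝ))))) *
            (4 * ((ξ * max 1 (supNorm w : ℝ)) ^ 2)⁻¹)) else 0)
      = ∑ w ∈ F, h (supNorm w) := by simp only [hh]
    _ ≤ h 0 + ∑ n ∈ Finset.Ico 1 (F.sup supNorm + 1), 26 * (n : ℝ) ^ 2 * h n := sum_radial_le h hh0 F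
    _ ≤ 0 + ∑ n ∈ Finset.Ico 1 (F.sup supNorm + 1),
          (if 2 * R ≤ n then 104 * ξ⁻¹ * Real.exp (-(2 * δ * (ξ * R))) * ((n : ℝ) ^ 2)⁻¹ else 0) := by
        rw [hz]
        gcongr with n hn
        exact hterm n (Finset.mem_Ico.1 hn).1
    _ = 104 * ξ⁻¹ * Real.exp (-(2 * δ * (ξ * R))) *
          ∑ n ∈ (Finset.Ico 1 (F.sup supNorm + 1)).filter (fun n => 2 * R ≤ n), ((n : ℝ) ^ 2)⁻¹ := by
        rw [zero_add, Finset.sum_filter, Finset.mul_sum]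
        refine Finset.sum_congr rfl fun n _ => ?_
        split_ifs <;> simp
    _ ≤ 104 * ξ⁻¹ * Real.exp (-(2 * δ * (ξ * R))) * (1 / (((2 * R : ℕ) : ℝ) - 1)) := by
        gcongr
        have hsub : (Finset.Ico 1 (F.sup supNorm + 1)).filter (fun n => 2 * R ≤ n) ⊆ Finset.Ico (2 * R) (F.sup supNorm + 1) := by
          intro n hn
          rw [Finset.mem_filter, Finset.mem_Ico] at hn
          rw [Finset.mem_Ico]
          omega
        refine (Finset.sum_le_sum_of_subset_of_nonneg hsub fun n _ _ => by positivity).trans ?_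
        exact sum_Ico_inv_sq_le (by omega) _
    _ ≤ 104 * ξ⁻¹ * Real.exp (-(2 * δ * (ξ * R))) * (1 / R) := by
        gcongr
        · push_cast; linarith
    _ = 104 * ((ξ * R)⁻¹ * Real.exp (-(2 * δ * (ξ * R)))) := by
        field_simp

/-- kernel: `((a/2)²)⁻¹ = 4·(a²)⁻¹`. [folklore] -/
private theorem inv_half_sq (a : ℝ) : ((a / 2) ^ 2)⁻¹ = 4 * (a ^ 2)⁻¹ := by
  rw [div_pow, inv_div]; ring

/-- kernel: the number of sites of sup norm `< 2R` is at most `64R³` (`R ≥ 1`). [cite: Balaban1983Higgs3, (3.16) p.437] -/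
theorem card_filter_supNorm_lt_le {R : ℕ} (hR : 1 ≤ R) (F : Finset (ZSite 3)) :
    ((F.filter (fun w => supNorm w < 2 * R)).card : ℝ) ≤ 64 * (R : ℝ) ^ 3 := by
  have hsub : F.filter (fun w => supNorm w < 2 * R) ⊆ Fintype.piFinset (fun _ : Fin 3 => Finset.Icc (-((2 * R - 1 : ℕ) : ℤ)) (2 * R - 1 : ℕ)) := by
    intro w hw
    rw [Finset.mem_filter] at hw
    rw [mem_box_iff]
    omega
  have h := Finset.card_le_card hsub
  rw [card_box] at h
  have h' : ((F.filter (fun w => supNorm w < 2 * R)).card : ℝ) ≤ (((2 * (2 * R - 1) + 1) ^ 3 : ℕ) : ℝ) := by exact_mod_cast h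
  refine h'.trans ?_
  have hR1 : (1 : ℝ) ≤ R := by exact_mod_cast hR
  have h4 : ((2 * (2 * R - 1) + 1 : ℕ) : ℝ) = 4 * R - 1 := by
    rw [Nat.cast_add, Nat.cast_mul, Nat.cast_sub (by omega)]; push_cast; ring
  rw [Nat.cast_pow, h4]
  nlinarith [sq_nonneg ((R : ℝ)), mul_pos (show (0:ℝ) < 4 * R - 1 by linarith) (show (0:ℝ) < R by linarith),
    mul_pos (mul_pos (show (0:ℝ) < 4 * R - 1 by linarith) (show (0:ℝ) < R by linarith)) (show (0:ℝ) < R by linarith)]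

/-- **THE SHARP COMPOSITION OF TWO ONCE-DIFFERENTIATED PROFILES, finite partial sums**: for `0 < ξ ≤ 1`, `0 < δ ≤ 1`, every
`v ∈ ℤ³` and every finite set of sites, `Σ_{w∈F} ξ³P₂^δ(w)P₂^δ(v − w) ≤ 1400·P₁^{δ/2}(v)` — the lattice form, uniform in the
spacing, of `∫dz |x−z|^{−2}|z−y|^{−2} ≲ |x−y|^{−1}` in three dimensions; the mechanism behind *"we can estimate (3.16) by a constant"*
when two differentiated propagators are composed. [cite: Balaban1983Higgs3, (3.16) p.437] -/
theorem conv22_sum_le (hξ : 0 < ξ) (hδ : 0 < δ) (v : ZSite 3) (F : Finset (ZSite 3)) :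
    ∑ w ∈ F, ξ ^ 3 * ((((ξ * max 1 (supNorm w : ℝ)) ^ 2)⁻¹ * Real.exp (-(δ * (ξ * (supNorm w : ℝ))))) *
        (((ξ * max 1 (supNorm (v - w) : ℝ)) ^ 2)⁻¹ * Real.exp (-(δ * (ξ * (supNorm (v - w) : ℝ))))))
      ≤ 1400 * ((ξ * max 1 (supNorm v : ℝ))⁻¹ * Real.exp (-(δ / 2 * (ξ * (supNorm v : ℝ))))) := by
  -- an opaque name for the profile
  obtain ⟨P, hP⟩ : ∃ P : ZSite 3 → ℝ, ∀ w, P w =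
      ((ξ * max 1 (supNorm w : ℝ)) ^ 2)⁻¹ * Real.exp (-(δ * (ξ * (supNorm w : ℝ)))) := ⟨_, fun w => rfl⟩
  have hP0 : ∀ w, 0 ≤ P w := fun w => by rw [hP]; positivity
  obtain ⟨R, hRdef⟩ : ∃ R : ℕ, supNorm v = R := ⟨_, rfl⟩
  -- the goal in `P`-form
  suffices hgoal : ∑ w ∈ F, ξ ^ 3 * (P w * P (v - w)) ≤
      1400 * ((ξ * max 1 (R : ℝ))⁻¹ * Real.exp (-(δ / 2 * (ξ * (R : ℝ))))) by
    rw [hRdef]; simpa only [hP] using hgoal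
  rcases Nat.eq_zero_or_pos R with hR0 | hRpos
  · -- `v = 0`: the sum of `ξ³P₂(w)²`
    have hv : v = 0 := (supNorm_eq_zero_iff v).1 (hRdef.trans hR0)
    have hre : ∀ w, ξ ^ 3 * (P w * P (v - w)) = ξ ^ 3 * (P w * P w) := by
      intro w; rw [hv, zero_sub, hP (-w), hP w, supNorm_neg]
    rw [hR0, Nat.cast_zero, max_eq_left (zero_le_one' ℝ), mul_one, mul_zero, mul_zero, neg_zero, Real.exp_zero, mul_one]
    rw [Finset.sum_congr rfl fun w _ => hre w]
    set h : ℕ → ℝ := fun n => ξ ^ 3 * ((((ξ * max 1 (n : ℝ)) ^ 2)⁻¹ * Real.exp (-(δ * (ξ * (n : ℝ))))) *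
        (((ξ * max 1 (n : ℝ)) ^ 2)⁻¹ * Real.exp (-(δ * (ξ * (n : ℝ)))))) with hh
    have hh0 : ∀ n, 0 ≤ h n := fun n => by positivity
    have hterm : ∀ n : ℕ, 1 ≤ n → 26 * (n : ℝ) ^ 2 * h n ≤ 26 * ξ⁻¹ * ((n : ℝ) ^ 2)⁻¹ := by
      intro n hn
      have hn1 : (1 : ℝ) ≤ n := by exact_mod_cast hn
      simp only [hh, max_eq_right hn1]
      have hE : Real.exp (-(δ * (ξ * (n : ℝ)))) ≤ 1 := Real.exp_le_one_iff.2 (by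
        have : 0 ≤ δ * (ξ * (n : ℝ)) := by positivity
        linarith)
      have hn0 : (0 : ℝ) < n := by linarith
      calc 26 * (n : ℝ) ^ 2 * (ξ ^ 3 * ((((ξ * n) ^ 2)⁻¹ * Real.exp (-(δ * (ξ * (n : ℝ))))) *
            (((ξ * n) ^ 2)⁻¹ * Real.exp (-(δ * (ξ * (n : ℝ)))))))
          ≤ 26 * (n : ℝ) ^ 2 * (ξ ^ 3 * ((((ξ * n) ^ 2)⁻¹ * 1) * (((ξ * n) ^ 2)⁻¹ * 1))) := by gcongr
        _ = 26 * ξ⁻¹ * ((n : ℝ) ^ 2)⁻¹ := by field_simp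
    have hz : h 0 = ξ⁻¹ := by
      simp only [hh, Nat.cast_zero, mul_zero, max_eq_left (zero_le_one' ℝ), mul_one, neg_zero, Real.exp_zero]
      field_simp
    have hPh : ∀ w, ξ ^ 3 * (P w * P w) = h (supNorm w) := fun w => by rw [hP]
    calc ∑ w ∈ F, ξ ^ 3 * (P w * P w) = ∑ w ∈ F, h (supNorm w) := Finset.sum_congr rfl fun w _ => hPh w
      _ ≤ h 0 + ∑ n ∈ Finset.Ico 1 (F.sup supNorm + 1), 26 * (n : ℝ) ^ 2 * h n := sum_radial_le h hh0 F
      _ ≤ ξ⁻¹ + ∑ n ∈ Finset.Ico 1 (F.sup supNorm + 1), 26 * ξ⁻¹ * ((n : ℝ) ^ 2)⁻¹ := by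
          rw [hz]
          exact add_le_add le_rfl (Finset.sum_le_sum fun n hn => hterm n (Finset.mem_Ico.1 hn).1)
      _ = ξ⁻¹ + 26 * ξ⁻¹ * ∑ n ∈ Finset.Ico 1 (F.sup supNorm + 1), ((n : ℝ) ^ 2)⁻¹ := by rw [Finset.mul_sum]
      _ ≤ ξ⁻¹ + 26 * ξ⁻¹ * 2 := by gcongr; exact sum_Ico_one_inv_sq_le _
      _ = 53 * ξ⁻¹ := by ring
      _ ≤ 1400 * ξ⁻¹ := by gcongr; norm_num
  · -- `R ≥ 1`: four regions
    have hR1 : (1 : ℝ) ≤ R := by exact_mod_cast hRpos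
    have hRr : (0 : ℝ) < R := by linarith
    have hx : 0 < ξ * R := mul_pos hξ hRr
    rw [max_eq_right hR1]
    obtain ⟨S, hS⟩ : ∃ S : ℝ, S = ((ξ * max 1 ((R : ℝ) / 2)) ^ 2)⁻¹ * Real.exp (-(δ * (ξ * ((R : ℝ) / 2)))) := ⟨_, rfl⟩
    have hS0 : 0 ≤ S := by rw [hS]; positivity
    -- `S ≤ 4(ξR)^{−2}e^{−δξR/2}`
    have hSle : S ≤ 4 * ((ξ * R) ^ 2)⁻¹ * Real.exp (-(δ / 2 * (ξ * R))) := by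
      have h1 : ((ξ * max 1 ((R : ℝ) / 2)) ^ 2)⁻¹ ≤ 4 * ((ξ * R) ^ 2)⁻¹ := by
        have hm : ξ * R / 2 ≤ ξ * max 1 ((R : ℝ) / 2) := by
          have := le_max_right 1 ((R : ℝ) / 2); nlinarith
        have hq : 0 < ξ * R / 2 := by positivity
        calc ((ξ * max 1 ((R : ℝ) / 2)) ^ 2)⁻¹ ≤ ((ξ * R / 2) ^ 2)⁻¹ :=
              inv_anti₀ (by positivity) (pow_le_pow_left₀ hq.le hm 2)
          _ = 4 * ((ξ * R) ^ 2)⁻¹ := inv_half_sq _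
      have h2 : Real.exp (-(δ * (ξ * ((R : ℝ) / 2)))) = Real.exp (-(δ / 2 * (ξ * R))) := by ring_nf
      rw [hS, h2]
      exact mul_le_mul_of_nonneg_right h1 (Real.exp_pos _).le
    -- the far bound: `P(u) ≤ S` whenever `2|u| ≥ R`
    have hfar : ∀ u : ZSite 3, ¬(2 * supNorm u < R) → P u ≤ S := by
      intro u hu
      have hu' : (R : ℝ) / 2 ≤ (supNorm u : ℝ) := by
        have : (R : ℝ) ≤ 2 * (supNorm u : ℝ) := by exact_mod_cast (not_lt.1 hu)
        linarith
      rw [hP, hS]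
      exact profile_antitone hξ hδ.le 2 u hu'
    -- pointwise majorant
    have hpt : ∀ w : ZSite 3, ξ ^ 3 * (P w * P (v - w)) ≤
        S * (if 2 * supNorm w < R then ξ ^ 3 * P w else 0) +
        S * (if 2 * supNorm (v - w) < R then ξ ^ 3 * P (v - w) else 0) +
        (if supNorm w < 2 * R then ξ ^ 3 * (S * S) else 0) +
        (if 2 * R ≤ supNorm w then ξ ^ 3 * (P w * (4 * ((ξ * max 1 (supNorm w : ℝ)) ^ 2)⁻¹)) else 0) := by
      intro w
      have hξ3 : 0 ≤ ξ ^ 3 := by positivity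
      have htri1 : R ≤ supNorm w + supNorm (v - w) := hRdef ▸ supNorm_le_add_sub v w
      have htri2 : supNorm w ≤ R + supNorm (v - w) := by
        have h := supNorm_le_add_sub w v
        rwa [← neg_sub v w, supNorm_neg, hRdef] at h
      have h2 : 0 ≤ S * (if 2 * supNorm (v - w) < R then ξ ^ 3 * P (v - w) else 0) := by
        split_ifs
        · exact mul_nonneg hS0 (mul_nonneg hξ3 (hP0 _))
        · simp
      have h3 : 0 ≤ (if supNorm w < 2 * R then ξ ^ 3 * (S * S) else 0) := by split_ifs <;> positivity
      have h4 : 0 ≤ (if 2 * R ≤ supNorm w then ξ ^ 3 * (P w * (4 * ((ξ * max 1 (supNorm w : ℝ)) ^ 2)⁻¹)) else 0) := by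
        split_ifs
        · exact mul_nonneg hξ3 (mul_nonneg (hP0 _) (by positivity))
        · simp
      by_cases hA : 2 * supNorm w < R
      · -- region A: the second factor is far
        have hB' : ¬(2 * supNorm (v - w) < R) := by omega
        rw [if_pos hA]
        have h1 : ξ ^ 3 * (P w * P (v - w)) ≤ S * (ξ ^ 3 * P w) := by
          calc ξ ^ 3 * (P w * P (v - w)) ≤ ξ ^ 3 * (P w * S) :=
                mul_le_mul_of_nonneg_left (mul_le_mul_of_nonneg_left (hfar _ hB') (hP0 _)) hξ3
            _ = S * (ξ ^ 3 * P w) := by ring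
        linarith
      · rw [if_neg hA, mul_zero, zero_add]
        have hPw : P w ≤ S := hfar w hA
        by_cases hB : 2 * supNorm (v - w) < R
        · -- region B: the first factor is far
          rw [if_pos hB] at h2 ⊢
          have h1 : ξ ^ 3 * (P w * P (v - w)) ≤ S * (ξ ^ 3 * P (v - w)) := by
            calc ξ ^ 3 * (P w * P (v - w)) ≤ ξ ^ 3 * (S * P (v - w)) :=
                  mul_le_mul_of_nonneg_left (mul_le_mul_of_nonneg_right hPw (hP0 _)) hξ3
              _ = S * (ξ ^ 3 * P (v - w)) := by ring
          linarith
        · rw [if_neg hB, mul_zero, zero_add]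
          have hPvw : P (v - w) ≤ S := hfar _ hB
          by_cases hC : supNorm w < 2 * R
          · -- region C: the annulus, both far
            rw [if_pos hC, if_neg (by omega), add_zero]
            exact mul_le_mul_of_nonneg_left (mul_le_mul hPw hPvw (hP0 _) hS0) hξ3
          · -- region E: the tail, `|v − w| ≥ |w|/2`
            rw [if_neg hC, zero_add, if_pos (by omega)]
            have hn2 : (2 : ℝ) * R ≤ (supNorm w : ℝ) := by exact_mod_cast (not_lt.1 hC)
            have hn1 : (1 : ℝ) ≤ (supNorm w : ℝ) := by linarith
            have hm : (supNorm w : ℝ) / 2 ≤ (supNorm (v - w) : ℝ) := by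
              have : (supNorm w : ℝ) ≤ R + (supNorm (v - w) : ℝ) := by exact_mod_cast htri2
              linarith
            have hfar2 := profile_antitone hξ hδ.le 2 (v - w) hm
            have hmax : ξ * max 1 (supNorm w : ℝ) / 2 ≤ ξ * max 1 ((supNorm w : ℝ) / 2) := by
              rw [max_eq_right hn1]
              have := le_max_right 1 ((supNorm w : ℝ) / 2)
              nlinarith
            have hq : 0 < ξ * max 1 (supNorm w : ℝ) / 2 := by positivity
            have hbd : P (v - w) ≤ 4 * ((ξ * max 1 (supNorm w : ℝ)) ^ 2)⁻¹ := by
              rw [hP]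
              refine hfar2.trans ?_
              calc ((ξ * max 1 ((supNorm w : ℝ) / 2)) ^ 2)⁻¹ * Real.exp (-(δ * (ξ * ((supNorm w : ℝ) / 2))))
                  ≤ ((ξ * max 1 ((supNorm w : ℝ) / 2)) ^ 2)⁻¹ * 1 := by
                    gcongr
                    exact Real.exp_le_one_iff.2 (by
                      have : 0 ≤ δ * (ξ * ((supNorm w : ℝ) / 2)) := by positivity
                      linarith)
                _ ≤ ((ξ * max 1 (supNorm w : ℝ) / 2) ^ 2)⁻¹ * 1 :=
                    mul_le_mul_of_nonneg_right (inv_anti₀ (by positivity) (pow_le_pow_left₀ hq.le hmax 2)) zero_le_one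
                _ = 4 * ((ξ * max 1 (supNorm w : ℝ)) ^ 2)⁻¹ := by rw [mul_one, inv_half_sq]
            exact mul_le_mul_of_nonneg_left (mul_le_mul_of_nonneg_left hbd (hP0 _)) hξ3
    -- the change of variables `u = v − w` for region B
    set e : ZSite 3 ↪ ZSite 3 := ⟨fun w => v - w, fun a b h => by simpa using h⟩ with he
    have hBsum : ∑ w ∈ F, (if 2 * supNorm (v - w) < R then ξ ^ 3 * P (v - w) else 0) =
        ∑ u ∈ F.map e, (if 2 * supNorm u < R then ξ ^ 3 * P u else 0) := by
      rw [Finset.sum_map]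
      rfl
    -- summing the majorant
    have hA : ∑ w ∈ F, (if 2 * supNorm w < R then ξ ^ 3 * P w else 0) ≤ 27 * ξ * R := by
      simpa only [hP] using sum_ball_profile_two_le hξ hδ.le hRpos F
    have hB : ∑ u ∈ F.map e, (if 2 * supNorm u < R then ξ ^ 3 * P u else 0) ≤ 27 * ξ * R := by
      simpa only [hP] using sum_ball_profile_two_le hξ hδ.le hRpos (F.map e)
    have hCc := card_filter_supNorm_lt_le hRpos F
    have hE : ∑ w ∈ F, (if 2 * R ≤ supNorm w then ξ ^ 3 * (P w * (4 * ((ξ * max 1 (supNorm w : ℝ)) ^ 2)⁻¹)) else 0)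
        ≤ 104 * ((ξ * R)⁻¹ * Real.exp (-(2 * δ * (ξ * R)))) := by
      simpa only [hP] using sum_tail_profile_le hξ hδ.le hRpos F
    have hsumC : ∑ w ∈ F, (if supNorm w < 2 * R then ξ ^ 3 * (S * S) else 0) ≤ 64 * (R : ℝ) ^ 3 * (ξ ^ 3 * (S * S)) := by
      rw [← Finset.sum_filter, Finset.sum_const, nsmul_eq_mul]
      exact mul_le_mul_of_nonneg_right hCc (by positivity)
    have htot : ∑ w ∈ F, ξ ^ 3 * (P w * P (v - w)) ≤
        S * (27 * ξ * R) + S * (27 * ξ * R) + 64 * (R : ℝ) ^ 3 * (ξ ^ 3 * (S * S)) +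
          104 * ((ξ * R)⁻¹ * Real.exp (-(2 * δ * (ξ * R)))) := by
      refine (Finset.sum_le_sum fun w _ => hpt w).trans ?_
      rw [Finset.sum_add_distrib, Finset.sum_add_distrib, Finset.sum_add_distrib, ← Finset.mul_sum, ← Finset.mul_sum, hBsum]
      gcongr
    -- the final arithmetic, with `x = ξR > 0`, `E = e^{−(δ/2)x}`
    refine htot.trans ?_
    obtain ⟨x, hxdef⟩ : ∃ x : ℝ, ξ * R = x := ⟨_, rfl⟩
    obtain ⟨E, hEdef⟩ : ∃ E : ℝ, Real.exp (-(δ / 2 * (ξ * R))) = E := ⟨_, rfl⟩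
    have hx0 : 0 < x := hxdef ▸ hx
    have hE0 : 0 < E := hEdef ▸ Real.exp_pos _
    have hE1 : E ≤ 1 := by
      rw [← hEdef]
      exact Real.exp_le_one_iff.2 (by
        have : 0 ≤ δ / 2 * (ξ * R) := by positivity
        linarith)
    rw [hEdef] at hSle; rw [hxdef] at hSle
    rw [hEdef, hxdef]
    have h1 : S * (27 * ξ * R) ≤ 108 * (x⁻¹ * E) := by
      calc S * (27 * ξ * R) ≤ 4 * (x ^ 2)⁻¹ * E * (27 * x) := by
            rw [show 27 * ξ * (R : ℝ) = 27 * x by rw [← hxdef]; ring]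
            exact mul_le_mul_of_nonneg_right hSle (by positivity)
        _ = 108 * (x⁻¹ * E) := by field_simp; norm_num
    have h2 : 64 * (R : ℝ) ^ 3 * (ξ ^ 3 * (S * S)) ≤ 1024 * (x⁻¹ * E) := by
      have hS2 : S * S ≤ (4 * (x ^ 2)⁻¹ * E) * (4 * (x ^ 2)⁻¹ * E) := mul_le_mul hSle hSle hS0 (by positivity)
      have hx3 : (R : ℝ) ^ 3 * ξ ^ 3 = x ^ 3 := by rw [← hxdef]; ring
      calc 64 * (R : ℝ) ^ 3 * (ξ ^ 3 * (S * S)) ≤ 64 * (R : ℝ) ^ 3 * (ξ ^ 3 * ((4 * (x ^ 2)⁻¹ * E) * (4 * (x ^ 2)⁻¹ * E))) := by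
            gcongr
        _ = 1024 * ((R : ℝ) ^ 3 * ξ ^ 3) * ((x ^ 2)⁻¹ * (x ^ 2)⁻¹) * E * E := by ring
        _ = 1024 * (x⁻¹ * E) * E := by rw [hx3]; field_simp
        _ ≤ 1024 * (x⁻¹ * E) * 1 := by gcongr
        _ = 1024 * (x⁻¹ * E) := by ring
    have h3 : 104 * (x⁻¹ * Real.exp (-(2 * δ * x))) ≤ 104 * (x⁻¹ * E) := by
      gcongr
      rw [← hEdef, ← hxdef]
      exact Real.exp_le_exp.2 (by nlinarith [hx.le, hδ.le])
    calc S * (27 * ξ * R) + S * (27 * ξ * R) + 64 * (R : ℝ) ^ 3 * (ξ ^ 3 * (S * S)) +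
          104 * (x⁻¹ * Real.exp (-(2 * δ * x)))
        ≤ 108 * (x⁻¹ * E) + 108 * (x⁻¹ * E) + 1024 * (x⁻¹ * E) + 104 * (x⁻¹ * E) := by gcongr
      _ = 1344 * (x⁻¹ * E) := by ring
      _ ≤ 1400 * (x⁻¹ * E) := by gcongr; norm_num

/-- **`conv22_le`: THE SHARP COMPOSITION ON ξℤ³** — for `0 < ξ ≤ 1`, `0 < δ ≤ 1` and every `v ∈ ℤ³` the lattice function
`w ↦ ξ³P₂^δ(w)P₂^δ(v − w)` is summable and `Σ'_w ξ³P₂^δ(w)P₂^δ(v−w) ≤ 1400·(ξ·max(1,|v|))^{−1}e^{−(δ/2)ξ|v|}`: two kernels with the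
law of a once-differentiated propagator compose to a kernel with the law of a propagator, uniformly in the spacing.
[cite: Balaban1983Higgs3, (3.16) p.437] -/
theorem conv22_le (hξ : 0 < ξ) (hδ : 0 < δ) (v : ZSite 3) :
    Summable (fun w : ZSite 3 => ξ ^ 3 * ((((ξ * max 1 (supNorm w : ℝ)) ^ 2)⁻¹ * Real.exp (-(δ * (ξ * (supNorm w : ℝ))))) *
        (((ξ * max 1 (supNorm (v - w) : ℝ)) ^ 2)⁻¹ * Real.exp (-(δ * (ξ * (supNorm (v - w) : ℝ))))))) ∧
      ∑' w : ZSite 3, ξ ^ 3 * ((((ξ * max 1 (supNorm w : ℝ)) ^ 2)⁻¹ * Real.exp (-(δ * (ξ * (supNorm w : ℝ))))) *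
        (((ξ * max 1 (supNorm (v - w) : ℝ)) ^ 2)⁻¹ * Real.exp (-(δ * (ξ * (supNorm (v - w) : ℝ))))))
        ≤ 1400 * ((ξ * max 1 (supNorm v : ℝ))⁻¹ * Real.exp (-(δ / 2 * (ξ * (supNorm v : ℝ))))) := by
  have h0 : ∀ w : ZSite 3, 0 ≤ ξ ^ 3 * ((((ξ * max 1 (supNorm w : ℝ)) ^ 2)⁻¹ * Real.exp (-(δ * (ξ * (supNorm w : ℝ))))) *
      (((ξ * max 1 (supNorm (v - w) : ℝ)) ^ 2)⁻¹ * Real.exp (-(δ * (ξ * (supNorm (v - w) : ℝ)))))) := fun w => by positivity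
  exact ⟨summable_of_sum_le h0 (conv22_sum_le hξ hδ v),
    Real.tsum_le_of_sum_le h0 (conv22_sum_le hξ hδ v)⟩

/-- **Two-point form** of `conv22_le`: `Σ'_z ξ³P₂^δ(x − z)P₂^δ(z − y) ≤ 1400·P₁^{δ/2}(x − y)` (and summable) — the shape in which
the mixed difference of the difference kernel `M = G(1 − m² − aP)C^ξ` of (3.16) and the Fubini form of the (3.26) cross terms
are composed. [cite: Balaban1983Higgs3, (3.16) p.437] -/
theorem conv22_le₂ (hξ : 0 < ξ) (hδ : 0 < δ) (x y : ZSite 3) :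
    Summable (fun z : ZSite 3 => ξ ^ 3 * ((((ξ * max 1 (supNorm (x - z) : ℝ)) ^ 2)⁻¹ * Real.exp (-(δ * (ξ * (supNorm (x - z) : ℝ))))) *
        (((ξ * max 1 (supNorm (z - y) : ℝ)) ^ 2)⁻¹ * Real.exp (-(δ * (ξ * (supNorm (z - y) : ℝ))))))) ∧
      ∑' z : ZSite 3, ξ ^ 3 * ((((ξ * max 1 (supNorm (x - z) : ℝ)) ^ 2)⁻¹ * Real.exp (-(δ * (ξ * (supNorm (x - z) : ℝ))))) *
        (((ξ * max 1 (supNorm (z - y) : ℝ)) ^ 2)⁻¹ * Real.exp (-(δ * (ξ * (supNorm (z - y) : ℝ))))))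
        ≤ 1400 * ((ξ * max 1 (supNorm (x - y) : ℝ))⁻¹ * Real.exp (-(δ / 2 * (ξ * (supNorm (x - y) : ℝ))))) := by
  obtain ⟨hs, hle⟩ := conv22_le hξ hδ (x - y)
  -- `z = x − w`: `x − z = w`, `z − y = (x − y) − w`
  set e : ZSite 3 ≃ ZSite 3 := Equiv.subLeft x with he
  have hre : ∀ w : ZSite 3,
      ξ ^ 3 * ((((ξ * max 1 (supNorm (x - e w) : ℝ)) ^ 2)⁻¹ * Real.exp (-(δ * (ξ * (supNorm (x - e w) : ℝ))))) *
        (((ξ * max 1 (supNorm (e w - y) : ℝ)) ^ 2)⁻¹ * Real.exp (-(δ * (ξ * (supNorm (e w - y) : ℝ))))))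
      = ξ ^ 3 * ((((ξ * max 1 (supNorm w : ℝ)) ^ 2)⁻¹ * Real.exp (-(δ * (ξ * (supNorm w : ℝ))))) *
        (((ξ * max 1 (supNorm (x - y - w) : ℝ)) ^ 2)⁻¹ * Real.exp (-(δ * (ξ * (supNorm (x - y - w) : ℝ)))))) := by
    intro w
    simp only [he, Equiv.subLeft_apply, sub_sub_cancel]
    rw [show x - w - y = x - y - w by abel]
  constructor
  · rw [← e.summable_iff]
    simp only [Function.comp_def, hre]
    exact hs
  · rw [← e.tsum_eq]
    simp only [hre]
    exact hle

end Conv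

/-! ## §4 Block averaging preserves the profiles -/

section Block

variable {ξ δ : ℝ}

/-- **BLOCK AVERAGING PRESERVES PROFILES** — the operator `P_k = Q_k^*Q_k` of (3.16) (average over the unit block, `n³` fine
sites, `n = ξ^{−1}`) maps a profile-bounded kernel to a profile-bounded kernel: for a finite set `S` of sites all within sup
distance `< n` of `z`, with `#S ≤ n³`, and `q ≤ 2`, `0 < ξ ≤ 1`, `ξn = 1`, `0 ≤ δ ≤ 1`:
`Σ_{z′∈S} ξ³P_q^δ(z′ − y) ≤ 2812e²·P_q^δ(z − y)` (far from `y` every `z′ ∈ S` is at distance `≥ |z−y|/2`; near `y` the left side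
is a local `L¹` mass `≤ 703` while `P_q^δ(z−y) ≥ e^{−2}/4`). [cite: Balaban1983Higgs3, (3.16) p.437] -/
theorem blockSum_profile_le (hξ : 0 < ξ) (hξ1 : ξ ≤ 1) (hδ0 : 0 ≤ δ) (hδ1 : δ ≤ 1) {q : ℕ} (hq : q ≤ 2) {n : ℕ}
    (hn : ξ * n = 1) (S : Finset (ZSite 3)) (z : ZSite 3) (hdiam : ∀ z' ∈ S, supNorm (z' - z) < n)
    (hcard : S.card ≤ n ^ 3) (y : ZSite 3) :
    ∑ z' ∈ S, ξ ^ 3 * (((ξ * max 1 (supNorm (z' - y) : ℝ)) ^ q)⁻¹ * Real.exp (-(δ * (ξ * (supNorm (z' - y) : ℝ)))))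
      ≤ 2812 * Real.exp 2 *
        (((ξ * max 1 (supNorm (z - y) : ℝ)) ^ q)⁻¹ * Real.exp (-(δ * (ξ * (supNorm (z - y) : ℝ))))) := by
  have hn1 : (1 : ℝ) ≤ n := by
    by_contra h
    have : (n : ℝ) < 1 := not_le.1 h
    nlinarith
  have hnpos : (0 : ℝ) < n := by linarith
  set m : ℕ := supNorm (z - y) with hmdef
  -- geometry: `|z′ − y| ≥ |z − y| − (n − 1)` and `|z′ − y| ≤ |z − y| + (n − 1)` for `z′ ∈ S`
  have hgeo : ∀ z' ∈ S, m ≤ supNorm (z' - y) + supNorm (z' - z) ∧ supNorm (z' - y) ≤ m + supNorm (z' - z) := by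
    intro z' hz'
    constructor
    · have h := supNorm_le_add_sub (z - y) (z' - y)
      rw [show z - y - (z' - y) = -(z' - z) by abel, supNorm_neg] at h
      exact h
    · have h := supNorm_le_add_sub (z' - y) (z - y)
      rw [show z' - y - (z - y) = z' - z by abel] at h
      exact h
  by_cases hfar : 2 * n ≤ m
  · -- far from `y`: every term is `≤ 2^q e^δ ξ³ P_q(z − y)`, and there are `≤ n³` of them
    have hm1 : (1 : ℝ) ≤ m := by
      have : (2 : ℝ) * n ≤ m := by exact_mod_cast hfar
      linarith
    have hterm : ∀ z' ∈ S, ((ξ * max 1 (supNorm (z' - y) : ℝ)) ^ q)⁻¹ * Real.exp (-(δ * (ξ * (supNorm (z' - y) : ℝ))))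
        ≤ 2 ^ q * Real.exp 1 * (((ξ * max 1 (m : ℝ)) ^ q)⁻¹ * Real.exp (-(δ * (ξ * (m : ℝ))))) := by
      intro z' hz'
      obtain ⟨h1, -⟩ := hgeo z' hz'
      have hd := hdiam z' hz'
      -- `|z′ − y| ≥ m − (n − 1) ≥ m/2`
      have hR : ((m : ℝ) - ((n : ℝ) - 1)) ≤ (supNorm (z' - y) : ℝ) := by
        have h1' : (m : ℝ) ≤ (supNorm (z' - y) : ℝ) + (supNorm (z' - z) : ℝ) := by exact_mod_cast h1
        have hd' : (supNorm (z' - z) : ℝ) + 1 ≤ n := by exact_mod_cast hd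
        linarith
      have hA := profile_antitone hξ hδ0 q (z' - y) hR
      refine hA.trans ?_
      have hhalf : (m : ℝ) / 2 ≤ (m : ℝ) - ((n : ℝ) - 1) := by
        have : (2 : ℝ) * n ≤ m := by exact_mod_cast hfar
        linarith
      have hmax : ξ * max 1 (m : ℝ) / 2 ≤ ξ * max 1 ((m : ℝ) - ((n : ℝ) - 1)) := by
        rw [max_eq_right hm1]
        have := le_max_right 1 ((m : ℝ) - ((n : ℝ) - 1))
        nlinarith
      have hpos : 0 < ξ * max 1 (m : ℝ) / 2 := by positivity
      have hpow : ((ξ * max 1 ((m : ℝ) - ((n : ℝ) - 1))) ^ q)⁻¹ ≤ 2 ^ q * ((ξ * max 1 (m : ℝ)) ^ q)⁻¹ := by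
        calc ((ξ * max 1 ((m : ℝ) - ((n : ℝ) - 1))) ^ q)⁻¹ ≤ ((ξ * max 1 (m : ℝ) / 2) ^ q)⁻¹ :=
              inv_anti₀ (pow_pos hpos q) (pow_le_pow_left₀ hpos.le hmax q)
          _ = 2 ^ q * ((ξ * max 1 (m : ℝ)) ^ q)⁻¹ := by rw [div_pow, inv_div, div_eq_mul_inv]
      have hexp : Real.exp (-(δ * (ξ * ((m : ℝ) - ((n : ℝ) - 1))))) ≤ Real.exp 1 * Real.exp (-(δ * (ξ * (m : ℝ)))) := by
        rw [← Real.exp_add]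
        refine Real.exp_le_exp.2 ?_
        have : δ * (ξ * ((n : ℝ) - 1)) ≤ 1 := by
          calc δ * (ξ * ((n : ℝ) - 1)) ≤ 1 * (ξ * n) := by
                apply mul_le_mul hδ1 (by nlinarith) (by nlinarith) zero_le_one
            _ = 1 := by rw [hn, one_mul]
        nlinarith
      calc ((ξ * max 1 ((m : ℝ) - ((n : ℝ) - 1))) ^ q)⁻¹ * Real.exp (-(δ * (ξ * ((m : ℝ) - ((n : ℝ) - 1)))))
          ≤ (2 ^ q * ((ξ * max 1 (m : ℝ)) ^ q)⁻¹) * (Real.exp 1 * Real.exp (-(δ * (ξ * (m : ℝ))))) :=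
            mul_le_mul hpow hexp (Real.exp_pos _).le (by positivity)
        _ = _ := by ring
    calc ∑ z' ∈ S, ξ ^ 3 * (((ξ * max 1 (supNorm (z' - y) : ℝ)) ^ q)⁻¹ * Real.exp (-(δ * (ξ * (supNorm (z' - y) : ℝ)))))
        ≤ ∑ z' ∈ S, ξ ^ 3 * (2 ^ q * Real.exp 1 * (((ξ * max 1 (m : ℝ)) ^ q)⁻¹ * Real.exp (-(δ * (ξ * (m : ℝ)))))) :=
          Finset.sum_le_sum fun z' hz' => mul_le_mul_of_nonneg_left (hterm z' hz') (by positivity)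
      _ = S.card * (ξ ^ 3 * (2 ^ q * Real.exp 1 * (((ξ * max 1 (m : ℝ)) ^ q)⁻¹ * Real.exp (-(δ * (ξ * (m : ℝ))))))) := by
          rw [Finset.sum_const, nsmul_eq_mul]
      _ ≤ (n : ℝ) ^ 3 * (ξ ^ 3 * (2 ^ q * Real.exp 1 * (((ξ * max 1 (m : ℝ)) ^ q)⁻¹ * Real.exp (-(δ * (ξ * (m : ℝ))))))) := by
          gcongr; exact_mod_cast hcard
      _ = 2 ^ q * Real.exp 1 * (((ξ * max 1 (m : ℝ)) ^ q)⁻¹ * Real.exp (-(δ * (ξ * (m : ℝ))))) := by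
          rw [show (n : ℝ) ^ 3 * (ξ ^ 3 * (2 ^ q * Real.exp 1 * (((ξ * max 1 (m : ℝ)) ^ q)⁻¹ * Real.exp (-(δ * (ξ * (m : ℝ)))))))
            = (ξ * n) ^ 3 * (2 ^ q * Real.exp 1 * (((ξ * max 1 (m : ℝ)) ^ q)⁻¹ * Real.exp (-(δ * (ξ * (m : ℝ)))))) by ring,
            hn, one_pow, one_mul]
      _ ≤ 2812 * Real.exp 2 * (((ξ * max 1 (m : ℝ)) ^ q)⁻¹ * Real.exp (-(δ * (ξ * (m : ℝ))))) := by
          refine mul_le_mul_of_nonneg_right ?_ (by positivity)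
          have h4 : (2 : ℝ) ^ q ≤ 4 := by
            calc (2 : ℝ) ^ q ≤ 2 ^ 2 := pow_le_pow_right₀ (by norm_num) hq
              _ = 4 := by norm_num
          have he : Real.exp 1 ≤ Real.exp 2 := Real.exp_le_exp.2 (by norm_num)
          have he0 : 0 < Real.exp 1 := Real.exp_pos 1
          nlinarith
  · -- near `y`: the left side is a local mass `≤ 703`, the right side is `≥ 2812e²·e^{−2}/4 = 703`
    rw [not_le] at hfar
    -- the left side
    set h : ℕ → ℝ := fun k => ξ ^ 3 * (((ξ * max 1 (k : ℝ)) ^ q)⁻¹ * Real.exp (-(δ * (ξ * (k : ℝ))))) with hh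
    have hh0 : ∀ k, 0 ≤ h k := fun k => by positivity
    set S' : Finset (ZSite 3) := S.map ⟨fun z' => z' - y, fun a b hab => by simpa using hab⟩ with hS'
    have hsum : ∑ z' ∈ S, ξ ^ 3 * (((ξ * max 1 (supNorm (z' - y) : ℝ)) ^ q)⁻¹ * Real.exp (-(δ * (ξ * (supNorm (z' - y) : ℝ)))))
        = ∑ u ∈ S', h (supNorm u) := by
      rw [hS', Finset.sum_map]; rfl
    have hsup : S'.sup supNorm + 1 ≤ 3 * n := by
      have : S'.sup supNorm < 3 * n := by
        rw [Finset.sup_lt_iff (show (⊥ : ℕ) < 3 * n by rw [Nat.bot_eq_zero]; omega)]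
        intro u hu
        rw [hS', Finset.mem_map] at hu
        obtain ⟨z', hz', rfl⟩ := hu
        obtain ⟨-, h2⟩ := hgeo z' hz'
        have hd := hdiam z' hz'
        show supNorm (z' - y) < 3 * n
        omega
      omega
    have hradial : ∑ u ∈ S', h (supNorm u) ≤ 703 := by
      refine (sum_radial_le h hh0 S').trans ?_
      have hz0 : h 0 ≤ 1 := by
        simp only [hh, Nat.cast_zero, max_eq_left (zero_le_one' ℝ), mul_one, mul_zero, neg_zero, Real.exp_zero]
        calc ξ ^ 3 * (ξ ^ q)⁻¹ = ξ ^ (3 - q) := by rw [pow_sub₀ ξ hξ.ne' (by omega : q ≤ 3)]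
          _ ≤ 1 := pow_le_one₀ hξ.le hξ1
      have hshell : ∀ k ∈ Finset.Ico 1 (S'.sup supNorm + 1), 26 * (k : ℝ) ^ 2 * h k ≤ 26 * (ξ ^ (3 - q) * (3 * n) ^ (2 - q)) := by
        intro k hk
        rw [Finset.mem_Ico] at hk
        have hk1 : (1 : ℝ) ≤ k := by exact_mod_cast hk.1
        have hk3 : (k : ℝ) ≤ 3 * n := by exact_mod_cast (show k ≤ 3 * n by omega)
        simp only [hh, max_eq_right hk1]
        have hE : Real.exp (-(δ * (ξ * (k : ℝ)))) ≤ 1 := Real.exp_le_one_iff.2 (by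
          have : 0 ≤ δ * (ξ * (k : ℝ)) := by positivity
          linarith)
        have hk0 : (0 : ℝ) < k := by linarith
        have hkq : (k : ℝ) ^ 2 * ((ξ * k) ^ q)⁻¹ = (ξ ^ q)⁻¹ * (k : ℝ) ^ (2 - q) := by
          rw [mul_pow, mul_inv]
          have : (k : ℝ) ^ 2 = (k : ℝ) ^ (2 - q) * (k : ℝ) ^ q := by rw [← pow_add]; congr 1; omega
          rw [this]; field_simp
        have hξq : ξ ^ 3 * (ξ ^ q)⁻¹ = ξ ^ (3 - q) := by rw [pow_sub₀ ξ hξ.ne' (by omega : q ≤ 3)]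
        calc 26 * (k : ℝ) ^ 2 * (ξ ^ 3 * (((ξ * k) ^ q)⁻¹ * Real.exp (-(δ * (ξ * (k : ℝ))))))
            ≤ 26 * (k : ℝ) ^ 2 * (ξ ^ 3 * (((ξ * k) ^ q)⁻¹ * 1)) := by gcongr
          _ = 26 * ((ξ ^ 3 * (ξ ^ q)⁻¹) * (k : ℝ) ^ (2 - q)) := by
              rw [mul_one, show 26 * (k : ℝ) ^ 2 * (ξ ^ 3 * ((ξ * k) ^ q)⁻¹) = 26 * (ξ ^ 3 * ((k : ℝ) ^ 2 * ((ξ * k) ^ q)⁻¹)) by ring,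
                hkq]; ring
          _ = 26 * (ξ ^ (3 - q) * (k : ℝ) ^ (2 - q)) := by rw [hξq]
          _ ≤ 26 * (ξ ^ (3 - q) * (3 * n) ^ (2 - q)) := by gcongr
      calc h 0 + ∑ k ∈ Finset.Ico 1 (S'.sup supNorm + 1), 26 * (k : ℝ) ^ 2 * h k
          ≤ 1 + ∑ k ∈ Finset.Ico 1 (S'.sup supNorm + 1), 26 * (ξ ^ (3 - q) * (3 * n) ^ (2 - q)) :=
            add_le_add hz0 (Finset.sum_le_sum hshell)
        _ = 1 + ((S'.sup supNorm + 1 - 1 : ℕ) : ℝ) * (26 * (ξ ^ (3 - q) * (3 * n) ^ (2 - q))) := by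
            rw [Finset.sum_const, Nat.card_Ico, nsmul_eq_mul]
        _ ≤ 1 + (3 * n) * (26 * (ξ ^ (3 - q) * (3 * n) ^ (2 - q))) := by
            gcongr
            exact_mod_cast (show S'.sup supNorm + 1 - 1 ≤ 3 * n by omega)
        _ = 1 + 26 * 3 ^ (3 - q) * (ξ * n) ^ (3 - q) := by
            have : (3 : ℝ) * n * (3 * n) ^ (2 - q) = (3 * n) ^ (3 - q) := by
              rw [← pow_succ', show 2 - q + 1 = 3 - q by omega]
            rw [show (3 : ℝ) * n * (26 * (ξ ^ (3 - q) * (3 * n) ^ (2 - q))) = 26 * ξ ^ (3 - q) * (3 * n * (3 * n) ^ (2 - q)) by ring,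
              this, mul_pow]; ring
        _ = 1 + 26 * 3 ^ (3 - q) := by rw [hn, one_pow, mul_one]
        _ ≤ 1 + 26 * 3 ^ 3 := by
            gcongr
            · norm_num
            · omega
        _ = 703 := by norm_num
    -- the right side
    have hm2 : ξ * max 1 (m : ℝ) ≤ 2 := by
      rcases le_or_gt (1 : ℝ) m with h1 | h1
      · rw [max_eq_right h1]
        have : (m : ℝ) < 2 * n := by exact_mod_cast hfar
        nlinarith
      · rw [max_eq_left h1.le]; linarith
    have hlow : Real.exp (-2) / 4 ≤ ((ξ * max 1 (m : ℝ)) ^ q)⁻¹ * Real.exp (-(δ * (ξ * (m : ℝ)))) := by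
      have hp : ((ξ * max 1 (m : ℝ)) ^ q)⁻¹ ≥ 1 / 4 := by
        rw [ge_iff_le, one_div]
        refine inv_anti₀ (by positivity) ?_
        calc (ξ * max 1 (m : ℝ)) ^ q ≤ 2 ^ q := pow_le_pow_left₀ (by positivity) hm2 q
          _ ≤ 2 ^ 2 := pow_le_pow_right₀ (by norm_num) hq
          _ = 4 := by norm_num
      have he : Real.exp (-2) ≤ Real.exp (-(δ * (ξ * (m : ℝ)))) := by
        refine Real.exp_le_exp.2 ?_
        have h1 : ξ * (m : ℝ) ≤ 2 := by
          have : (m : ℝ) < 2 * n := by exact_mod_cast hfar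
          nlinarith
        have : δ * (ξ * (m : ℝ)) ≤ 1 * 2 := mul_le_mul hδ1 h1 (by positivity) zero_le_one
        linarith
      calc Real.exp (-2) / 4 = 1 / 4 * Real.exp (-2) := by ring
        _ ≤ ((ξ * max 1 (m : ℝ)) ^ q)⁻¹ * Real.exp (-(δ * (ξ * (m : ℝ)))) :=
            mul_le_mul hp he (Real.exp_pos _).le (by positivity)
    have hee : Real.exp 2 * Real.exp (-2) = 1 := by rw [← Real.exp_add]; norm_num
    calc ∑ z' ∈ S, ξ ^ 3 * (((ξ * max 1 (supNorm (z' - y) : ℝ)) ^ q)⁻¹ * Real.exp (-(δ * (ξ * (supNorm (z' - y) : ℝ)))))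
        = ∑ u ∈ S', h (supNorm u) := hsum
      _ ≤ 703 := hradial
      _ = 2812 * Real.exp 2 * (Real.exp (-2) / 4) := by
          rw [show 2812 * Real.exp 2 * (Real.exp (-2) / 4) = 703 * (Real.exp 2 * Real.exp (-2)) by ring, hee, mul_one]
      _ ≤ 2812 * Real.exp 2 * (((ξ * max 1 (m : ℝ)) ^ q)⁻¹ * Real.exp (-(δ * (ξ * (m : ℝ))))) :=
          mul_le_mul_of_nonneg_left hlow (by positivity)

end Block

/-! ## §5 Translated `L¹` bounds and the product of two propagator profiles -/

section Shifted

variable {ξ δ : ℝ}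

/-- kernel: a profile is at most `ξ^{−q}` (`0 < ξ`, `0 ≤ δ`). [cite: Balaban1983Higgs3, (3.16) p.437] -/
theorem profile_le_inv_pow (hξ : 0 < ξ) (hδ : 0 ≤ δ) (q : ℕ) (u : ZSite 3) :
    ((ξ * max 1 (supNorm u : ℝ)) ^ q)⁻¹ * Real.exp (-(δ * (ξ * (supNorm u : ℝ)))) ≤ (ξ ^ q)⁻¹ := by
  have hm : (1 : ℝ) ≤ max 1 (supNorm u : ℝ) := le_max_left _ _
  have h1 : ((ξ * max 1 (supNorm u : ℝ)) ^ q)⁻¹ ≤ (ξ ^ q)⁻¹ :=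
    inv_anti₀ (pow_pos hξ q) (pow_le_pow_left₀ hξ.le (le_mul_of_one_le_right hξ.le hm) q)
  have h2 : Real.exp (-(δ * (ξ * (supNorm u : ℝ)))) ≤ 1 := Real.exp_le_one_iff.2 (by
    have : 0 ≤ δ * (ξ * (supNorm u : ℝ)) := by positivity
    linarith)
  calc ((ξ * max 1 (supNorm u : ℝ)) ^ q)⁻¹ * Real.exp (-(δ * (ξ * (supNorm u : ℝ)))) ≤ (ξ ^ q)⁻¹ * 1 :=
      mul_le_mul h1 h2 (Real.exp_pos _).le (by positivity)
    _ = (ξ ^ q)⁻¹ := mul_one _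

/-- **Translated `L¹` bounds** (both orientations): `z ↦ ξ³P_q^δ(x − z)` and `z ↦ ξ³P_q^δ(z − y)` are summable on ℤ³ with sums
`≤ 833/δ³` (`q ≤ 2`, `0 < ξ ≤ 1`, `0 < δ ≤ 1`; gen-8's `tsum_profile_le` after the lattice translations `z ↦ x − z`, `z ↦ z − y`).
[cite: Balaban1983Higgs3, (3.16) p.437] -/
theorem tsum_profile_shift_le (hξ : 0 < ξ) (hξ1 : ξ ≤ 1) (hδ : 0 < δ) (hδ1 : δ ≤ 1) {q : ℕ} (hq : q ≤ 2) (x y : ZSite 3) :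
    (Summable (fun z : ZSite 3 =>
        ξ ^ 3 * (((ξ * max 1 (supNorm (x - z) : ℝ)) ^ q)⁻¹ * Real.exp (-(δ * (ξ * (supNorm (x - z) : ℝ)))))) ∧
      ∑' z : ZSite 3, ξ ^ 3 * (((ξ * max 1 (supNorm (x - z) : ℝ)) ^ q)⁻¹ * Real.exp (-(δ * (ξ * (supNorm (x - z) : ℝ)))))
        ≤ 833 / δ ^ 3) ∧
    (Summable (fun z : ZSite 3 =>
        ξ ^ 3 * (((ξ * max 1 (supNorm (z - y) : ℝ)) ^ q)⁻¹ * Real.exp (-(δ * (ξ * (supNorm (z - y) : ℝ)))))) ∧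
      ∑' z : ZSite 3, ξ ^ 3 * (((ξ * max 1 (supNorm (z - y) : ℝ)) ^ q)⁻¹ * Real.exp (-(δ * (ξ * (supNorm (z - y) : ℝ)))))
        ≤ 833 / δ ^ 3) := by
  obtain ⟨hs, hle⟩ := tsum_profile_le (d := 3) rfl hξ hξ1 hδ hδ1 hq
  have e1 := (Equiv.subLeft x).tsum_eq (fun u : ZSite 3 =>
    ξ ^ 3 * (((ξ * max 1 (supNorm u : ℝ)) ^ q)⁻¹ * Real.exp (-(δ * (ξ * (supNorm u : ℝ))))))
  have e2 := (Equiv.subRight y).tsum_eq (fun u : ZSite 3 =>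
    ξ ^ 3 * (((ξ * max 1 (supNorm u : ℝ)) ^ q)⁻¹ * Real.exp (-(δ * (ξ * (supNorm u : ℝ))))))
  simp only [Equiv.subLeft_apply] at e1
  simp only [Equiv.subRight_apply] at e2
  refine ⟨⟨?_, ?_⟩, ⟨?_, ?_⟩⟩
  · exact (Equiv.subLeft x).summable_iff.2 hs
  · rw [e1]; exact hle
  · exact (Equiv.subRight y).summable_iff.2 hs
  · rw [e2]; exact hle

/-- **The product of two propagator profiles is uniformly summable**: `z ↦ ξ³P₁^δ(x − z)P₁^δ(z − y)` is summable and
`Σ'_z ξ³P₁^δ(x−z)P₁^δ(z−y) ≤ 833/δ³` for all `x, y` (`0 < ξ ≤ 1`, `0 < δ ≤ 1`) — by `ab ≤ ½(a² + b²)` and `P₁² ≤ P₂`: the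
undifferentiated-propagator pairs of (3.16)/(3.26) (e.g. `|G(y,z)|·|C(z−y′)|`) are summable uniformly in the spacing and in
the positions. [cite: Balaban1983Higgs3, (3.16) p.437] -/
theorem tsum_profile_one_mul_le (hξ : 0 < ξ) (hξ1 : ξ ≤ 1) (hδ : 0 < δ) (hδ1 : δ ≤ 1) (x y : ZSite 3) :
    Summable (fun z : ZSite 3 => ξ ^ 3 *
        ((((ξ * max 1 (supNorm (x - z) : ℝ)) ^ 1)⁻¹ * Real.exp (-(δ * (ξ * (supNorm (x - z) : ℝ))))) *
          (((ξ * max 1 (supNorm (z - y) : ℝ)) ^ 1)⁻¹ * Real.exp (-(δ * (ξ * (supNorm (z - y) : ℝ))))))) ∧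
      ∑' z : ZSite 3, ξ ^ 3 *
        ((((ξ * max 1 (supNorm (x - z) : ℝ)) ^ 1)⁻¹ * Real.exp (-(δ * (ξ * (supNorm (x - z) : ℝ))))) *
          (((ξ * max 1 (supNorm (z - y) : ℝ)) ^ 1)⁻¹ * Real.exp (-(δ * (ξ * (supNorm (z - y) : ℝ))))))
        ≤ 833 / δ ^ 3 := by
  obtain ⟨⟨hs1, hle1⟩, ⟨hs2, hle2⟩⟩ := tsum_profile_shift_le hξ hξ1 hδ hδ1 (le_refl 2) x y
  -- `P₁(u)² ≤ P₂(u)` (the exponential squared is smaller)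
  have hsq : ∀ u : ZSite 3, (((ξ * max 1 (supNorm u : ℝ)) ^ 1)⁻¹ * Real.exp (-(δ * (ξ * (supNorm u : ℝ))))) ^ 2 ≤
      ((ξ * max 1 (supNorm u : ℝ)) ^ 2)⁻¹ * Real.exp (-(δ * (ξ * (supNorm u : ℝ)))) := by
    intro u
    rw [pow_one, mul_pow, ← inv_pow, sq (Real.exp _)]
    refine mul_le_mul_of_nonneg_left ?_ (by positivity)
    have hE1 : Real.exp (-(δ * (ξ * (supNorm u : ℝ)))) ≤ 1 := Real.exp_le_one_iff.2 (by
      have : 0 ≤ δ * (ξ * (supNorm u : ℝ)) := by positivity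
      linarith)
    calc Real.exp (-(δ * (ξ * (supNorm u : ℝ)))) * Real.exp (-(δ * (ξ * (supNorm u : ℝ))))
        ≤ Real.exp (-(δ * (ξ * (supNorm u : ℝ)))) * 1 := mul_le_mul_of_nonneg_left hE1 (Real.exp_pos _).le
      _ = _ := mul_one _
  -- pointwise AM–GM
  have hpt : ∀ z : ZSite 3, ξ ^ 3 *
      ((((ξ * max 1 (supNorm (x - z) : ℝ)) ^ 1)⁻¹ * Real.exp (-(δ * (ξ * (supNorm (x - z) : ℝ))))) *
        (((ξ * max 1 (supNorm (z - y) : ℝ)) ^ 1)⁻¹ * Real.exp (-(δ * (ξ * (supNorm (z - y) : ℝ)))))) ≤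
      (1 / 2) * (ξ ^ 3 * (((ξ * max 1 (supNorm (x - z) : ℝ)) ^ 2)⁻¹ * Real.exp (-(δ * (ξ * (supNorm (x - z) : ℝ)))))) +
      (1 / 2) * (ξ ^ 3 * (((ξ * max 1 (supNorm (z - y) : ℝ)) ^ 2)⁻¹ * Real.exp (-(δ * (ξ * (supNorm (z - y) : ℝ)))))) := by
    intro z
    set a := ((ξ * max 1 (supNorm (x - z) : ℝ)) ^ 1)⁻¹ * Real.exp (-(δ * (ξ * (supNorm (x - z) : ℝ)))) with ha
    set b := ((ξ * max 1 (supNorm (z - y) : ℝ)) ^ 1)⁻¹ * Real.exp (-(δ * (ξ * (supNorm (z - y) : ℝ)))) with hb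
    have hab : a * b ≤ (1 / 2) * a ^ 2 + (1 / 2) * b ^ 2 := by nlinarith [sq_nonneg (a - b)]
    have hξ3 : 0 ≤ ξ ^ 3 := by positivity
    calc ξ ^ 3 * (a * b) ≤ ξ ^ 3 * ((1 / 2) * a ^ 2 + (1 / 2) * b ^ 2) := mul_le_mul_of_nonneg_left hab hξ3
      _ ≤ ξ ^ 3 * ((1 / 2) * (((ξ * max 1 (supNorm (x - z) : ℝ)) ^ 2)⁻¹ * Real.exp (-(δ * (ξ * (supNorm (x - z) : ℝ))))) +
          (1 / 2) * (((ξ * max 1 (supNorm (z - y) : ℝ)) ^ 2)⁻¹ * Real.exp (-(δ * (ξ * (supNorm (z - y) : ℝ)))))) := by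
          gcongr
          · exact hsq (x - z)
          · exact hsq (z - y)
      _ = _ := by ring
  have hmaj : Summable (fun z : ZSite 3 =>
      (1 / 2) * (ξ ^ 3 * (((ξ * max 1 (supNorm (x - z) : ℝ)) ^ 2)⁻¹ * Real.exp (-(δ * (ξ * (supNorm (x - z) : ℝ)))))) +
      (1 / 2) * (ξ ^ 3 * (((ξ * max 1 (supNorm (z - y) : ℝ)) ^ 2)⁻¹ * Real.exp (-(δ * (ξ * (supNorm (z - y) : ℝ))))))) :=
    (hs1.mul_left _).add (hs2.mul_left _)
  have h0 : ∀ z : ZSite 3, 0 ≤ ξ ^ 3 *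
      ((((ξ * max 1 (supNorm (x - z) : ℝ)) ^ 1)⁻¹ * Real.exp (-(δ * (ξ * (supNorm (x - z) : ℝ))))) *
        (((ξ * max 1 (supNorm (z - y) : ℝ)) ^ 1)⁻¹ * Real.exp (-(δ * (ξ * (supNorm (z - y) : ℝ)))))) := fun z => by positivity
  have hsum := Summable.of_nonneg_of_le h0 hpt hmaj
  refine ⟨hsum, ?_⟩
  calc _ ≤ ∑' z : ZSite 3, ((1 / 2) * (ξ ^ 3 * (((ξ * max 1 (supNorm (x - z) : ℝ)) ^ 2)⁻¹ *
          Real.exp (-(δ * (ξ * (supNorm (x - z) : ℝ)))))) +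
        (1 / 2) * (ξ ^ 3 * (((ξ * max 1 (supNorm (z - y) : ℝ)) ^ 2)⁻¹ * Real.exp (-(δ * (ξ * (supNorm (z - y) : ℝ))))))) :=
        hsum.tsum_le_tsum hpt hmaj
    _ = (1 / 2) * ∑' z : ZSite 3, ξ ^ 3 * (((ξ * max 1 (supNorm (x - z) : ℝ)) ^ 2)⁻¹ *
          Real.exp (-(δ * (ξ * (supNorm (x - z) : ℝ))))) +
        (1 / 2) * ∑' z : ZSite 3, ξ ^ 3 * (((ξ * max 1 (supNorm (z - y) : ℝ)) ^ 2)⁻¹ *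
          Real.exp (-(δ * (ξ * (supNorm (z - y) : ℝ))))) := by
        rw [(hs1.mul_left _).tsum_add (hs2.mul_left _), hs1.tsum_mul_left (1 / 2), hs2.tsum_mul_left (1 / 2)]
    _ ≤ (1 / 2) * (833 / δ ^ 3) + (1 / 2) * (833 / δ ^ 3) := by gcongr
    _ = 833 / δ ^ 3 := by ring

end Shifted

end

end Literature.MathematicalPhysics.QuantumFieldTheory.Balaban1983to89.B3ZdKernelConvolutions
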